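/- Free-seat work of LEAD seat `ym-line-cbag-p1` (prover-ym-line-cbag-p1-g22-0; own crux stmt-QuantumFields-22254 closed) on the
planner-of-record's LINE 7, route `GlueballBandRecursion`: the recursion ENGINE behind the landed Assembly (stmt-QuantumFields-27509,
`GlueballBandRecursion.assembly_proof`), per gauge group and representation and with abstract multiplicity weights — so that the
critic's priced DICHOTOMY (idea-crit-4 verdict 2026-08-28T10:49Z, P1: one-glueball BAND ∨ ISOLATED bottom level) assembles into the
rung by the same algebra (`C = 512·A·e^D/a²` resp. `C = 8·A′·e^D`). -/
import Summits.QuantumFields.YangMills.Theorems.GlueballBandRecursionRateToolkit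
import Summits.QuantumFields.YangMills.Theorems.BalabanLadderIRColdPurityBridgeSpectral

/-!
# Route `GlueballBandRecursion`: the cold-doubling recursion engine, per `(G, r)` and with abstract weights

For ONE compact group `G` and ONE faithful unitary lattice representation `r` (no quantifier over groups, no `Theses` import), on
the strong-coupling window `0 ≤ β ≤ strongCouplingRadius r.ρ`, with `x_t(N) = traceExcess r.ρ β N t`, `q_N = ⨅ₖ x_{k+2}(N)^{1/(k+2)}`,
`t = ⌊L/4⌋`, `t' = ⌊L'/4⌋`, `2L ≤ L' ≤ 4L`:

* `coldDoublingRecursion_of_weights` — finite-size stability `q_{L'} ≤ e^{D/L} q_L` (K1 at `(G,r)`), a CEILING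
  `x_{t}(N) ≤ U(N)·q_N^{t}` and a FLOOR `ℓ(N)·q_N^{t} ≤ x_{t}(N)` with weights satisfying `U(L') ≤ K·ℓ(L)²` give
  `δᶜ(L') ≤ 8·K·e^{D}·δᶜ(L)²` for `L ≥ L₀` (dictionary `2x/(1+x)² ≤ δᶜ ≤ 2x`, window smallness `x ≤ 1`);
* `coldDoublingRecursion_of_band` — the BAND weights `U = A·N³`, `ℓ = a·N^{3/2}` (K2, K3 at `(G,r)`): `C = 512·A·e^{D}/a²`
  (the per-`(G,r)` content of `assembly_proof`);
* `coldDoublingRecursion_of_isolated` — the ISOLATED weights `U = A′`, `ℓ = 1` (the floor `q^t ≤ x_t` is automatic,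
  `Rate.rate_pow_le_traceExcess`): `C = 8·A′·e^{D}` — the critic's branch 2 («K3 false there while the rung holds more easily»).

HONEST FRAMING.  Implications only: the band/isolated bounds and the stability K1 are HYPOTHESES here (the route's open cruxes or
their priced variants); the conclusion is the `(G, r)`-instance of the RECORD-type rung `ColdDoublingRecursionStrongCoupling`.
Nothing about weak coupling, the continuum or the Yang–Mills mass gap (Clay) is proved by anything in this file.
-/

set_option autoImplicit false

noncomputable section

open Filter Topology
open Literature.MathematicalPhysics.QuantumFieldTheory
open Literature.MathematicalPhysics.QuantumFieldTheory.Balaban1983to89.Missing (strongCouplingRadius)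
open Summit.QuantumFields.YangMills.Cruxes.IR.ColdPurityBridge (coldDefect one_sub_ratio_le_two_mul_traceExcess
  one_sub_ratio_ge_of_traceExcess)
open Summit.QuantumFields.YangMills.Theorems.GlueballBandRecursion.Rate (traceExcess_nonneg rate_nonneg
  rate_pow_le_traceExcess rate_le_one_of_traceExcess_le_one traceExcess_small_of_large)

namespace Summit.QuantumFields.YangMills.Theorems.GlueballBandRecursion

variable {G : Type} [Group G] [TopologicalSpace G] [IsTopologicalGroup G] [CompactSpace G]
  [MeasurableSpace G] [BorelSpace G]

/-- **The engine.**  At fixed `(G, r)`: K1-stability with drift `D ≥ 0` from `L ≥ L₁`, a ceiling `x_{m+2}(N) ≤ U(N)·q_N^{m+2}`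
from `N ≥ L₂`, a floor `ℓ(N)·q_N^{m+2} ≤ x_{m+2}(N)` from `N ≥ L₃` with `ℓ > 0`, and the weight domination
`U(L') ≤ K·ℓ(L)²` for `L ≥ L₄`, `2L ≤ L' ≤ 4L` (`K > 0`) give the cold doubling recursion
`δᶜ(L') ≤ 8·K·e^{D}·δᶜ(L)²` for all `L ≥ L₀`, `2L ≤ L' ≤ 4L`, uniformly on the strong-coupling window. -/
theorem coldDoublingRecursion_of_weights (r : LatticeRep G) {D K : ℝ} (hD : 0 ≤ D) (hK : 0 < K)
    (U ℓ : ℕ → ℝ) (hℓ : ∀ N, 0 < ℓ N) {L₁ L₂ L₃ L₄ : ℕ}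
    (hUℓ : ∀ L L' : ℕ, L₄ ≤ L → 2 * L ≤ L' → L' ≤ 4 * L → U L' ≤ K * ℓ L ^ 2)
    (hK1 : ∀ β : ℝ, 0 ≤ β → β ≤ strongCouplingRadius r.ρ →
      ∀ (L : ℕ) [NeZero L] (L' : ℕ) [NeZero L'], L₁ ≤ L → 2 * L ≤ L' → L' ≤ 4 * L →
        (⨅ k : ℕ, traceExcess r.ρ β L' (k + 2) ^ ((1 : ℝ) / ((k : ℝ) + 2))) ≤
          Real.exp (D / (L : ℝ)) * (⨅ k : ℕ, traceExcess r.ρ β L (k + 2) ^ ((1 : ℝ) / ((k : ℝ) + 2))))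
    (hup : ∀ β : ℝ, 0 ≤ β → β ≤ strongCouplingRadius r.ρ →
      ∀ (N : ℕ) [NeZero N] (m : ℕ), N / 4 = m + 2 → L₂ ≤ N →
        traceExcess r.ρ β N (m + 2) ≤
          U N * (⨅ k : ℕ, traceExcess r.ρ β N (k + 2) ^ ((1 : ℝ) / ((k : ℝ) + 2))) ^ (m + 2))
    (hlow : ∀ β : ℝ, 0 ≤ β → β ≤ strongCouplingRadius r.ρ →
      ∀ (N : ℕ) [NeZero N] (m : ℕ), N / 4 = m + 2 → L₃ ≤ N →
        ℓ N * (⨅ k : ℕ, traceExcess r.ρ β N (k + 2) ^ ((1 : ℝ) / ((k : ℝ) + 2))) ^ (m + 2) ≤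
          traceExcess r.ρ β N (m + 2)) :
    ∃ L₀ : ℕ, ∀ β : ℝ, 0 ≤ β → β ≤ strongCouplingRadius r.ρ →
      ∀ L : ℕ, L₀ ≤ L → ∀ L' : ℕ, 2 * L ≤ L' → L' ≤ 4 * L →
        coldDefect r.ρ β L' ≤ 8 * K * Real.exp D * coldDefect r.ρ β L ^ 2 := by
  haveI : SecondCountableTopology G :=
    (r.continuous.isClosedEmbedding r.injective).isEmbedding.secondCountableTopology
  obtain ⟨L₅, hK5⟩ := traceExcess_small_of_large (ρ := r.ρ) r.continuous r.mem_unitary one_pos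
  refine ⟨max (max L₁ L₂) (max (max L₃ L₄) (max L₅ 8)), ?_⟩
  intro β hβ0 hβ L hL L' hLL' hL'L
  have hL₁ : L₁ ≤ L := le_trans (le_trans (le_max_left _ _) (le_max_left _ _)) hL
  have hL₂ : L₂ ≤ L' := by
    have : L₂ ≤ L := le_trans (le_trans (le_max_right _ _) (le_max_left _ _)) hL
    omega
  have hL₃ : L₃ ≤ L := le_trans (le_trans (le_trans (le_max_left _ _) (le_max_left _ _)) (le_max_right _ _)) hL
  have hL₄ : L₄ ≤ L := le_trans (le_trans (le_trans (le_max_right _ _) (le_max_left _ _)) (le_max_right _ _)) hL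
  have hL₅ : L₅ ≤ L :=
    le_trans (le_trans (le_trans (le_max_left _ _) (le_max_right _ _)) (le_max_right _ _)) hL
  have hL8 : 8 ≤ L :=
    le_trans (le_trans (le_trans (le_max_right _ _) (le_max_right _ _)) (le_max_right _ _)) hL
  haveI : NeZero L := ⟨by omega⟩
  haveI : NeZero L' := ⟨by omega⟩
  obtain ⟨m, hm⟩ : ∃ m : ℕ, L / 4 = m + 2 := ⟨L / 4 - 2, by omega⟩
  obtain ⟨m', hm'⟩ : ∃ m' : ℕ, L' / 4 = m' + 2 := ⟨L' / 4 - 2, by omega⟩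
  have htt : 2 * (m + 2) ≤ m' + 2 := by omega
  have ht'L : m' + 2 ≤ L := by omega
  -- abbreviations
  set qL : ℝ := ⨅ k : ℕ, traceExcess r.ρ β L (k + 2) ^ ((1 : ℝ) / ((k : ℝ) + 2)) with hqLdef
  set qL' : ℝ := ⨅ k : ℕ, traceExcess r.ρ β L' (k + 2) ^ ((1 : ℝ) / ((k : ℝ) + 2)) with hqL'def
  set x : ℝ := traceExcess r.ρ β L (m + 2) with hxdef
  set x' : ℝ := traceExcess r.ρ β L' (m' + 2) with hx'def
  set δ : ℝ := coldDefect r.ρ β L with hδdef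
  set δ' : ℝ := coldDefect r.ρ β L' with hδ'def
  -- ranges
  have hx0 : 0 ≤ x := traceExcess_nonneg r.continuous r.mem_unitary hβ0 L m
  have hx1 : x ≤ 1 := hK5 β hβ0 hβ L m hm hL₅
  have hqL0 : 0 ≤ qL := rate_nonneg r.continuous r.mem_unitary hβ0 L
  have hqL'0 : 0 ≤ qL' := rate_nonneg r.continuous r.mem_unitary hβ0 L'
  have hqL1 : qL ≤ 1 := rate_le_one_of_traceExcess_le_one r.continuous r.mem_unitary hβ0 L m hx1
  -- hypotheses, instantiated
  have h1 : qL' ≤ Real.exp (D / (L : ℝ)) * qL := hK1 β hβ0 hβ L L' hL₁ hLL' hL'L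
  have h2 : x' ≤ U L' * qL' ^ (m' + 2) := hup β hβ0 hβ L' m' hm' hL₂
  have h3 : ℓ L * qL ^ (m + 2) ≤ x := hlow β hβ0 hβ L m hm hL₃
  have h4 : U L' ≤ K * ℓ L ^ 2 := hUℓ L L' hL₄ hLL' hL'L
  -- dictionary
  have hup' : δ' ≤ 2 * x' := by
    have h := one_sub_ratio_le_two_mul_traceExcess r hβ0 L' m'
    rw [hδ'def]; unfold coldDefect; rw [hm']; exact h
  have hlow' : 2 * x / (1 + x) ^ 2 ≤ δ := by
    have h := one_sub_ratio_ge_of_traceExcess r hβ0 L m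
    rw [hδdef]; unfold coldDefect; rw [hm]; exact h
  have hxδ : x ≤ 2 * δ := by
    have h1x : (0 : ℝ) < (1 + x) ^ 2 := by positivity
    have hsq : (1 + x) ^ 2 ≤ 4 := by nlinarith
    have : x / 2 ≤ 2 * x / (1 + x) ^ 2 := by
      rw [le_div_iff₀ h1x]
      have : x / 2 * (1 + x) ^ 2 ≤ x / 2 * 4 := mul_le_mul_of_nonneg_left hsq (by positivity)
      linarith
    linarith
  have hδ0 : 0 ≤ δ := by linarith
  -- powers of the rate
  set y : ℝ := qL ^ (m + 2) with hydef
  have hy0 : 0 ≤ y := pow_nonneg hqL0 _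
  have hexpD : Real.exp (D / (L : ℝ)) ^ (m' + 2) ≤ Real.exp D := by
    rw [← Real.exp_nat_mul]
    refine Real.exp_le_exp.2 ?_
    have hLpos : (0 : ℝ) < L := by exact_mod_cast (show 0 < L by omega)
    have ht' : ((m' + 2 : ℕ) : ℝ) ≤ L := by exact_mod_cast ht'L
    rw [div_eq_mul_inv, show ((m' + 2 : ℕ) : ℝ) * (D * (L : ℝ)⁻¹) = D * (((m' + 2 : ℕ) : ℝ) / L) by ring]
    have hfrac : ((m' + 2 : ℕ) : ℝ) / L ≤ 1 := by rw [div_le_one hLpos]; exact ht'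
    nlinarith
  have hpow : qL' ^ (m' + 2) ≤ Real.exp D * y ^ 2 := by
    calc qL' ^ (m' + 2) ≤ (Real.exp (D / (L : ℝ)) * qL) ^ (m' + 2) := pow_le_pow_left₀ hqL'0 h1 _
      _ = Real.exp (D / (L : ℝ)) ^ (m' + 2) * qL ^ (m' + 2) := mul_pow _ _ _
      _ ≤ Real.exp D * qL ^ (2 * (m + 2)) :=
          mul_le_mul hexpD (pow_le_pow_of_le_one hqL0 hqL1 htt) (pow_nonneg hqL0 _) (by positivity)
      _ = Real.exp D * y ^ 2 := by rw [hydef, ← pow_mul, mul_comm (m + 2) 2]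
  -- upper side: `δ' ≤ 2·K·e^D·(ℓ(L)²·y²)`
  have hupper : δ' ≤ 2 * K * Real.exp D * (ℓ L ^ 2 * y ^ 2) := by
    calc δ' ≤ 2 * x' := hup'
      _ ≤ 2 * (U L' * qL' ^ (m' + 2)) := by linarith
      _ ≤ 2 * ((K * ℓ L ^ 2) * (Real.exp D * y ^ 2)) := by
          gcongr
      _ = 2 * K * Real.exp D * (ℓ L ^ 2 * y ^ 2) := by ring
  -- lower side: `ℓ(L)²·y² ≤ 4δ²`
  have hay : ℓ L * y ≤ 2 * δ := h3.trans hxδ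
  have hay0 : 0 ≤ ℓ L * y := mul_nonneg (hℓ L).le hy0
  have hkey : ℓ L ^ 2 * y ^ 2 ≤ 4 * δ ^ 2 := by
    have hsqle : (ℓ L * y) ^ 2 ≤ (2 * δ) ^ 2 := pow_le_pow_left₀ hay0 hay 2
    nlinarith [hsqle]
  -- conclusion
  calc δ' ≤ 2 * K * Real.exp D * (ℓ L ^ 2 * y ^ 2) := hupper
    _ ≤ 2 * K * Real.exp D * (4 * δ ^ 2) := mul_le_mul_of_nonneg_left hkey (by positivity)
    _ = 8 * K * Real.exp D * δ ^ 2 := by ring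

/-- **Band weights** (the per-`(G,r)` content of the landed `assembly_proof`): K1-stability with drift `D`, the extensive
CEILING `x_{⌊N/4⌋}(N) ≤ A·N³·q_N^{⌊N/4⌋}` (K2 at `(G,r)`) and the band FLOOR `a·N^{3/2}·q_N^{⌊N/4⌋} ≤ x_{⌊N/4⌋}(N)` (K3 at `(G,r)`)
give `δᶜ(L') ≤ (512·A·e^{D}/a²)·δᶜ(L)²` for `L ≥ L₀`, `2L ≤ L' ≤ 4L`, uniformly on the strong-coupling window. -/
theorem coldDoublingRecursion_of_band (r : LatticeRep G) {D A a : ℝ} (hD : 0 ≤ D) (hA : 0 < A) (ha : 0 < a)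
    {L₁ L₂ L₃ : ℕ}
    (hK1 : ∀ β : ℝ, 0 ≤ β → β ≤ strongCouplingRadius r.ρ →
      ∀ (L : ℕ) [NeZero L] (L' : ℕ) [NeZero L'], L₁ ≤ L → 2 * L ≤ L' → L' ≤ 4 * L →
        (⨅ k : ℕ, traceExcess r.ρ β L' (k + 2) ^ ((1 : ℝ) / ((k : ℝ) + 2))) ≤
          Real.exp (D / (L : ℝ)) * (⨅ k : ℕ, traceExcess r.ρ β L (k + 2) ^ ((1 : ℝ) / ((k : ℝ) + 2))))
    (hK2 : ∀ β : ℝ, 0 ≤ β → β ≤ strongCouplingRadius r.ρ →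
      ∀ (N : ℕ) [NeZero N] (m : ℕ), N / 4 = m + 2 → L₂ ≤ N →
        traceExcess r.ρ β N (m + 2) ≤
          A * (N : ℝ) ^ 3 * (⨅ k : ℕ, traceExcess r.ρ β N (k + 2) ^ ((1 : ℝ) / ((k : ℝ) + 2))) ^ (m + 2))
    (hK3 : ∀ β : ℝ, 0 ≤ β → β ≤ strongCouplingRadius r.ρ →
      ∀ (N : ℕ) [NeZero N] (m : ℕ), N / 4 = m + 2 → L₃ ≤ N →
        a * Real.sqrt (N : ℝ) ^ 3 * (⨅ k : ℕ, traceExcess r.ρ β N (k + 2) ^ ((1 : ℝ) / ((k : ℝ) + 2))) ^ (m + 2) ≤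
          traceExcess r.ρ β N (m + 2)) :
    ∃ L₀ : ℕ, ∀ β : ℝ, 0 ≤ β → β ≤ strongCouplingRadius r.ρ →
      ∀ L : ℕ, L₀ ≤ L → ∀ L' : ℕ, 2 * L ≤ L' → L' ≤ 4 * L →
        coldDefect r.ρ β L' ≤ 512 * A * Real.exp D / a ^ 2 * coldDefect r.ρ β L ^ 2 := by
  -- weights: `U N = A·N³`, `ℓ N = a·√N³` (the floor weight is used only at `N = L ≥ 8 ≥ 1`, where `√N > 0`)
  obtain ⟨L₀, h⟩ := coldDoublingRecursion_of_weights r hD (show 0 < 64 * A / a ^ 2 by positivity)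
    (fun N => A * (N : ℝ) ^ 3) (fun N => a * Real.sqrt (max (N : ℝ) 1) ^ 3)
    (fun N => by positivity) (L₁ := L₁) (L₂ := L₂) (L₃ := max L₃ 1) (L₄ := 1)
    (fun L L' hL hLL' hL'L => by
      have hL1 : (1 : ℝ) ≤ L := by exact_mod_cast hL
      have hmax : max (L : ℝ) 1 = L := max_eq_left hL1
      have hs : Real.sqrt (L : ℝ) ^ 2 = L := Real.sq_sqrt (by positivity)
      have hs3 : (Real.sqrt (L : ℝ) ^ 3) ^ 2 = (L : ℝ) ^ 3 := by
        calc (Real.sqrt (L : ℝ) ^ 3) ^ 2 = (Real.sqrt (L : ℝ) ^ 2) ^ 3 := by ring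
          _ = (L : ℝ) ^ 3 := by rw [hs]
      have hL'R : (L' : ℝ) ≤ 4 * L := by exact_mod_cast hL'L
      have hL'3 : (L' : ℝ) ^ 3 ≤ 64 * (L : ℝ) ^ 3 := by
        calc (L' : ℝ) ^ 3 ≤ (4 * (L : ℝ)) ^ 3 := pow_le_pow_left₀ (by positivity) hL'R 3
          _ = 64 * (L : ℝ) ^ 3 := by ring
      rw [hmax]
      calc A * (L' : ℝ) ^ 3 ≤ A * (64 * (L : ℝ) ^ 3) := by gcongr
        _ = 64 * A / a ^ 2 * (a * Real.sqrt (L : ℝ) ^ 3) ^ 2 := by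
            rw [mul_pow, hs3]; field_simp)
    hK1 hK2
    (fun β hβ0 hβ N _ m hm hN => by
      have hN1 : (1 : ℝ) ≤ N := by exact_mod_cast le_trans (le_max_right _ _) hN
      have hmax : max (N : ℝ) 1 = N := max_eq_left hN1
      rw [hmax]
      exact hK3 β hβ0 hβ N m hm (le_trans (le_max_left _ _) hN))
  refine ⟨L₀, fun β hβ0 hβ L hL L' hLL' hL'L => ?_⟩
  have h' := h β hβ0 hβ L hL L' hLL' hL'L
  have hC : 8 * (64 * A / a ^ 2) * Real.exp D = 512 * A * Real.exp D / a ^ 2 := by ring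
  rw [hC] at h'
  exact h'

/-- **Isolated weights** (the critic's branch 2): K1-stability with drift `D` and a FLAT ceiling
`x_{⌊N/4⌋}(N) ≤ A′·q_N^{⌊N/4⌋}` (the bottom excited level of the torus transfer matrix isolated with bounded multiplicity — the case
in which the band floor K3 FAILS) give the rung instance MORE EASILY: `δᶜ(L') ≤ 8·A′·e^{D}·δᶜ(L)²` (the floor `q^t ≤ x_t` is the
one-state floor `Rate.rate_pow_le_traceExcess`). -/
theorem coldDoublingRecursion_of_isolated (r : LatticeRep G) {D A' : ℝ} (hD : 0 ≤ D) (hA' : 0 < A') {L₁ L₂ : ℕ}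
    (hK1 : ∀ β : ℝ, 0 ≤ β → β ≤ strongCouplingRadius r.ρ →
      ∀ (L : ℕ) [NeZero L] (L' : ℕ) [NeZero L'], L₁ ≤ L → 2 * L ≤ L' → L' ≤ 4 * L →
        (⨅ k : ℕ, traceExcess r.ρ β L' (k + 2) ^ ((1 : ℝ) / ((k : ℝ) + 2))) ≤
          Real.exp (D / (L : ℝ)) * (⨅ k : ℕ, traceExcess r.ρ β L (k + 2) ^ ((1 : ℝ) / ((k : ℝ) + 2))))
    (hIso : ∀ β : ℝ, 0 ≤ β → β ≤ strongCouplingRadius r.ρ →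
      ∀ (N : ℕ) [NeZero N] (m : ℕ), N / 4 = m + 2 → L₂ ≤ N →
        traceExcess r.ρ β N (m + 2) ≤
          A' * (⨅ k : ℕ, traceExcess r.ρ β N (k + 2) ^ ((1 : ℝ) / ((k : ℝ) + 2))) ^ (m + 2)) :
    ∃ L₀ : ℕ, ∀ β : ℝ, 0 ≤ β → β ≤ strongCouplingRadius r.ρ →
      ∀ L : ℕ, L₀ ≤ L → ∀ L' : ℕ, 2 * L ≤ L' → L' ≤ 4 * L →
        coldDefect r.ρ β L' ≤ 8 * A' * Real.exp D * coldDefect r.ρ β L ^ 2 := by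
  haveI : SecondCountableTopology G :=
    (r.continuous.isClosedEmbedding r.injective).isEmbedding.secondCountableTopology
  exact coldDoublingRecursion_of_weights r hD hA' (fun _ => A') (fun _ => 1) (fun _ => one_pos)
    (L₁ := L₁) (L₂ := L₂) (L₃ := 0) (L₄ := 0)
    (fun L L' _ _ _ => by simp) hK1 hIso
    (fun β hβ0 _ N _ m _ _ => by
      simpa using rate_pow_le_traceExcess (ρ := r.ρ) r.continuous r.mem_unitary hβ0 N m)

end Summit.QuantumFields.YangMills.Theorems.GlueballBandRecursion

end
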